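import Summits.ResolutionOfSingularities.ResolutionOfSingularities.Theorems.EquisingularLiftEquisingularLiftNatSpecimenWhitneyCubicAlgebra
import Literature.AlgebraicGeometry.Motives.HypersurfaceCharts
import Literature.AlgebraicGeometry.Motives.HypersurfaceChartAlgebra
import Literature.AlgebraicGeometry.Motives.HypersurfaceFormsIrreducible
import Literature.AlgebraicGeometry.Motives.SmoothHypersurfaceIrreducible
import Literature.AlgebraicGeometry.Motives.ProjectiveSpaceFieldPointsBijective
import Literature.AlgebraicGeometry.Resolution.ComponentGluing
import Literature.AlgebraicGeometry.Resolution.PointBlowupAlgebraCharts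
import HarnessLib

/-!
# [OURS · L1 W4.5(b)] EL♮ specimen R2 — the WHITNEY-TYPE CUBIC `x₁x₂² = x₀x₃²`: the form, the hypersurface, the chart rings
# crux `Theses.EquisingularLift.EquisingularLiftNat` (stmt-ResolutionOfSingularities-20038), res-L1-w45b-plan-1 ORDERS (R2)

NOT a statement of any manuscript; OURS kernel specimen (cell `res-hironaka`, chain w45b, seat res-D-pv-022). AI-written,
weaker than expert review.

The specimen `H = V₊(F) ⊂ ℙ³_k`, `F = x₁x₂² − x₀x₃²` (the ordered `V(x₀²x₃ − x₁²x₂)` after the coordinate renaming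
`(0 2)(1 3)`), over an ARBITRARY field `k`, as an instance of the binders of the item `EquisingularLiftNat`: `H` is the
tree's REDUCED hypersurface `Motives.SmoothHypersurface.hypersurface F` with its closed immersion `hypersurfaceι F` onto
`V₊(F)` (Hartshorne II Example 3.2.6); `F` is prime, so `H` is INTEGRAL. On the standard chart `D₊(x_c)` the chart ring
`ChartRing F c = (k[x]_{(x_c)})₀ / √(F/x_c³)` (`Motives/HypersurfaceCharts`) is identified with `k[y₀,y₁,y₂]/(f_c)` for the
dehomogenized equations `f_c` of `…WhitneyCubicAlgebra` (`f₀ = y₀y₁² − y₂²`, `f₁ = y₁² − y₀y₂²`, `f₂ = y₁ − y₀y₂²`,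
`f₃ = y₁y₂² − y₀`; all four generate RADICAL ideals: `f₀, f₁` prime by Eisenstein at a rational point, `f₂, f₃` with regular
quotient), the tautological coordinates `x_{c.succAbove j}/x_c` going to `ȳ_j` (dehomogenization `chartAlgEquiv`,
Hartshorne I Thm 3.4).

* `form`, `isHomogeneous_form`, `prime_form` (degree one in `x₀` after `x₀ ↔ x₁`, with relatively prime coefficients
  `x₂², −x₁x₃²`: `Polynomial.irreducible_C_mul_X_add_C`), `prime_f₀`, `prime_f₁`, `dehomogenize_form_*`;
* `isIntegral_hypersurface` — `V₊(F)` irreducible (`isIrreducible_zeroLocus_of_prime`) and reduced;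
* `chartQuotEquiv c` — `ChartRing F c ≃+* k[y]/(f_c)` with `chartQuotEquiv_tautVec` (`x_{c.succAbove j}/x_c ↦ ȳ_j`).

References: Hartshorne 1977 I Thm 3.4, II Ex. 2.9, Example 3.2.6; the cited tree files.
-/

set_option linter.dupNamespace false -- mandated namespace `Summit.<Summit>.<Problem>` of this single-conjunct summit

noncomputable section

open MvPolynomial HomogeneousLocalization
open Literature.AlgebraicGeometry.Motives Literature.AlgebraicGeometry.Motives.SmoothHypersurface
open Literature.AlgebraicGeometry.Motives.ProjectiveSpace

namespace Summit.ResolutionOfSingularities.ResolutionOfSingularities.Cruxes.EquisingularLiftNat.Sections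

namespace WhitneyCubic

variable (k : Type) [Field k]

attribute [local instance] MvPolynomial.gradedAlgebra ProjBaseChange.algebraBase

/-! ## The form `F = x₁x₂² − x₀x₃²` -/

/-- **The Whitney-type cubic form** `F = x₁x₂² − x₀x₃² ∈ k[x₀, x₁, x₂, x₃]` (singular along the double line
`V(x₂, x₃)`; the ordered `x₀²x₃ − x₁²x₂` after renaming the coordinates by `(0 2)(1 3)`). [folklore] -/
def form : MvPolynomial (Fin 4) k := X 1 * X 2 ^ 2 - X 0 * X 3 ^ 2

/-- `F` is homogeneous of degree `3`. [folklore] -/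
theorem isHomogeneous_form : (form k).IsHomogeneous 3 := by
  have h1 : (X 1 * X 2 ^ 2 : MvPolynomial (Fin 4) k).IsHomogeneous 3 := by
    simpa using (isHomogeneous_X k (1 : Fin 4)).mul ((isHomogeneous_X k (2 : Fin 4)).pow 2)
  have h2 : (X 0 * X 3 ^ 2 : MvPolynomial (Fin 4) k).IsHomogeneous 3 := by
    simpa using (isHomogeneous_X k (0 : Fin 4)).mul ((isHomogeneous_X k (3 : Fin 4)).pow 2)
  exact h1.sub h2

/-- `F` is the ordered form `x₀²x₃ − x₁²x₂` with the coordinates renamed by `(0 2)(1 3)`. [folklore] -/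
theorem form_eq_rename :
    form k = rename ((Equiv.swap (0 : Fin 4) 2).trans (Equiv.swap (1 : Fin 4) 3)) (X 0 ^ 2 * X 3 - X 1 ^ 2 * X 2) := by
  simp [form, rename_X, Equiv.swap_apply_def]
  ring

/-- In `x₀`-adic form after `x₀ ↔ x₁`: `F(x₁, x₀, x₂, x₃) = x₂²·x₀ − x₁x₃²`, i.e. `C(y₁²)·Y + C(−y₀y₂²)` over `k[y₀, y₁, y₂]`
(`y = (x₁, x₂, x₃)`). [folklore] -/
theorem finSuccEquiv_rename_form :
    finSuccEquiv k 3 (rename (Equiv.swap (0 : Fin 4) 1) (form k)) =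
      Polynomial.C (X 1 ^ 2) * Polynomial.X + Polynomial.C (-(X 0 * X 2 ^ 2)) := by
  have h1 : finSuccEquiv k 3 (X 1) = Polynomial.C (X 0) := finSuccEquiv_X_succ (j := 0)
  have h2 : finSuccEquiv k 3 (X 2) = Polynomial.C (X 1) := finSuccEquiv_X_succ (j := 1)
  have h3 : finSuccEquiv k 3 (X 3) = Polynomial.C (X 2) := finSuccEquiv_X_succ (j := 2)
  simp only [form, map_sub, map_mul, map_pow, rename_X, Equiv.swap_apply_left, Equiv.swap_apply_right,
    Equiv.swap_apply_of_ne_of_ne (show (2 : Fin 4) ≠ 0 by decide) (show (2 : Fin 4) ≠ 1 by decide),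
    Equiv.swap_apply_of_ne_of_ne (show (3 : Fin 4) ≠ 0 by decide) (show (3 : Fin 4) ≠ 1 by decide),
    finSuccEquiv_X_zero, h1, h2, h3, map_neg]
  ring

/-- The coefficients `y₁²` and `−y₀y₂²` are relatively prime in `k[y₀, y₁, y₂]` (a divisor of `y₁²` is a unit or divisible
by the prime `y₁`, which divides neither `y₀` nor `y₂`). [folklore] -/
theorem isRelPrime_coeff : IsRelPrime (X 1 ^ 2 : MvPolynomial (Fin 3) k) (-(X 0 * X 2 ^ 2)) := by
  intro d hd1 hd2
  have hp : Prime (X 1 : MvPolynomial (Fin 3) k) := X_prime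
  obtain ⟨i, hi, hassoc⟩ := (dvd_prime_pow hp 2).mp hd1
  rcases Nat.eq_zero_or_pos i with rfl | hi0
  · rw [pow_zero] at hassoc
    exact hassoc.symm.isUnit isUnit_one
  · exfalso
    have hX1d : (X 1 : MvPolynomial (Fin 3) k) ∣ d :=
      (dvd_pow_self (X 1) hi0.ne').trans hassoc.symm.dvd
    have h : (X 1 : MvPolynomial (Fin 3) k) ∣ X 0 * X 2 ^ 2 := (hX1d.trans hd2).trans (neg_dvd.mpr dvd_rfl)
    rcases hp.dvd_or_dvd h with h0 | h2
    · exact absurd (X_dvd_X.mp h0) (by decide)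
    · exact absurd (X_dvd_X.mp (hp.dvd_of_dvd_pow h2)) (by decide)

/-- **`F` is prime** in `k[x₀, …, x₃]` (degree one in `x₀` after `x₀ ↔ x₁` with relatively prime coefficients, Mathlib
`Polynomial.irreducible_C_mul_X_add_C`; polynomial rings are factorial). [folklore] -/
theorem prime_form : Prime (form k) := by
  have hirr : Irreducible (rename (Equiv.swap (0 : Fin 4) 1) (form k)) := by
    rw [← MulEquiv.irreducible_iff (finSuccEquiv k 3), finSuccEquiv_rename_form]
    exact Polynomial.irreducible_C_mul_X_add_C (pow_ne_zero 2 (X_ne_zero 1)) (isRelPrime_coeff k)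
  have hirr' : Irreducible (form k) :=
    (MulEquiv.irreducible_iff (renameEquiv k (Equiv.swap (0 : Fin 4) 1)).toMulEquiv (x := form k)).mp hirr
  exact UniqueFactorizationMonoid.irreducible_iff_prime.mp hirr'

/-! ## The dehomogenized equations -/

/-- `x_a(x_i := 1) = y_j` when `a = i.succAbove j` (index bookkeeping for `dehomogenize`). [folklore] -/
theorem dehomogenize_X_of_eq (i a : Fin 4) (j : Fin 3) (h : a = i.succAbove j) :
    dehomogenize k i (X a) = X j := by
  rw [h, dehomogenize_X_succAbove]

/-- `F(x₀ := 1) = f₀ = y₀y₁² − y₂²` in `k[y] = k[x₁, x₂, x₃]`. [folklore] -/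
theorem dehomogenize_form_zero : dehomogenize k (0 : Fin 4) (form k) = f₀ k := by
  simp only [form, f₀, map_sub, map_mul, map_pow, dehomogenize_X_self,
    dehomogenize_X_of_eq k 0 1 0 (by decide), dehomogenize_X_of_eq k 0 2 1 (by decide),
    dehomogenize_X_of_eq k 0 3 2 (by decide), one_mul]

/-- `F(x₁ := 1) = f₁ = y₁² − y₀y₂²` (`y = (x₀, x₂, x₃)`). [folklore] -/
theorem dehomogenize_form_one : dehomogenize k (1 : Fin 4) (form k) = f₁ k := by
  simp only [form, f₁, map_sub, map_mul, map_pow, dehomogenize_X_self,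
    dehomogenize_X_of_eq k 1 0 0 (by decide), dehomogenize_X_of_eq k 1 2 1 (by decide),
    dehomogenize_X_of_eq k 1 3 2 (by decide), one_mul]

/-- `F(x₂ := 1) = f₂ = y₁ − y₀y₂²` (`y = (x₀, x₁, x₃)`). [folklore] -/
theorem dehomogenize_form_two : dehomogenize k (2 : Fin 4) (form k) = f₂ k := by
  simp only [form, f₂, map_sub, map_mul, map_pow, dehomogenize_X_self,
    dehomogenize_X_of_eq k 2 0 0 (by decide), dehomogenize_X_of_eq k 2 1 1 (by decide),
    dehomogenize_X_of_eq k 2 3 2 (by decide), one_pow, mul_one]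

/-- `F(x₃ := 1) = f₃ = y₁y₂² − y₀` (`y = (x₀, x₁, x₂)`). [folklore] -/
theorem dehomogenize_form_three : dehomogenize k (3 : Fin 4) (form k) = f₃ k := by
  simp only [form, f₃, map_sub, map_mul, map_pow, dehomogenize_X_self,
    dehomogenize_X_of_eq k 3 0 0 (by decide), dehomogenize_X_of_eq k 3 1 1 (by decide),
    dehomogenize_X_of_eq k 3 2 2 (by decide), one_pow, mul_one]

/-! ## The dehomogenized equations on the charts meeting the double line are prime -/

/-- `f₀ = y₀y₁² − y₂²` is prime: after `y₀ ↔ y₂`, `−f₀ = Y² − y₁²y₀… ` is `Y² + C(−z₀²z₁)` over `k[z₀, z₁]`, Eisenstein at the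
point `(1, 0)` (`∂(−z₀²z₁)/∂z₁ = −z₀² ≠ 0` there). [folklore] -/
theorem prime_f₀ : Prime (f₀ k) := by
  have hfin : finSuccEquiv k 2 (rename (Equiv.swap (0 : Fin 3) 2) (-f₀ k)) =
      Polynomial.X ^ 2 + Polynomial.C (-(X 0 ^ 2 * X 1)) := by
    have h1 : finSuccEquiv k 2 (X 1) = Polynomial.C (X 0) := finSuccEquiv_X_succ (j := 0)
    have h2 : finSuccEquiv k 2 (X 2) = Polynomial.C (X 1) := finSuccEquiv_X_succ (j := 1)
    simp only [f₀, map_neg, map_sub, map_mul, map_pow, rename_X, Equiv.swap_apply_left, Equiv.swap_apply_right,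
      Equiv.swap_apply_of_ne_of_ne (show (1 : Fin 3) ≠ 0 by decide) (show (1 : Fin 3) ≠ 2 by decide),
      finSuccEquiv_X_zero, h1, h2]
    ring
  have hirr : Irreducible (rename (Equiv.swap (0 : Fin 3) 2) (-f₀ k)) := by
    rw [← MulEquiv.irreducible_iff (finSuccEquiv k 2), hfin]
    refine irreducible_X_pow_add_C (by norm_num) _ ![1, 0] ?_ 1 ?_
    · simp
    · simp [Derivation.leibniz_pow]
  have hirr' : Irreducible (-f₀ k) :=
    (MulEquiv.irreducible_iff (renameEquiv k (Equiv.swap (0 : Fin 3) 2)).toMulEquiv (x := -f₀ k)).mp hirr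
  have hprime : Prime (-f₀ k) := UniqueFactorizationMonoid.irreducible_iff_prime.mp hirr'
  simpa using hprime.neg

/-- `f₁ = y₁² − y₀y₂²` is prime: after `y₀ ↔ y₁` it is `Y² + C(−z₀z₁²)` over `k[z₀, z₁]`, Eisenstein at `(0, 1)`
(`∂(−z₀z₁²)/∂z₀ = −z₁² ≠ 0` there). [folklore] -/
theorem prime_f₁ : Prime (f₁ k) := by
  have hfin : finSuccEquiv k 2 (rename (Equiv.swap (0 : Fin 3) 1) (f₁ k)) =
      Polynomial.X ^ 2 + Polynomial.C (-(X 0 * X 1 ^ 2)) := by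
    have h1 : finSuccEquiv k 2 (X 1) = Polynomial.C (X 0) := finSuccEquiv_X_succ (j := 0)
    have h2 : finSuccEquiv k 2 (X 2) = Polynomial.C (X 1) := finSuccEquiv_X_succ (j := 1)
    simp only [f₁, map_sub, map_mul, map_pow, rename_X, Equiv.swap_apply_left, Equiv.swap_apply_right,
      Equiv.swap_apply_of_ne_of_ne (show (2 : Fin 3) ≠ 0 by decide) (show (2 : Fin 3) ≠ 1 by decide),
      finSuccEquiv_X_zero, h1, h2, map_neg]
    ring
  have hirr : Irreducible (rename (Equiv.swap (0 : Fin 3) 1) (f₁ k)) := by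
    rw [← MulEquiv.irreducible_iff (finSuccEquiv k 2), hfin]
    refine irreducible_X_pow_add_C (by norm_num) _ ![0, 1] ?_ 0 ?_
    · simp
    · simp [Derivation.leibniz_pow]
  have hirr' : Irreducible (f₁ k) :=
    (MulEquiv.irreducible_iff (renameEquiv k (Equiv.swap (0 : Fin 3) 1)).toMulEquiv (x := f₁ k)).mp hirr
  exact UniqueFactorizationMonoid.irreducible_iff_prime.mp hirr'

/-- `(f₀)` is a radical ideal. [folklore] -/
theorem radical_span_f₀ : (Ideal.span {f₀ k}).radical = Ideal.span {f₀ k} :=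
  ((Ideal.span_singleton_prime (prime_f₀ k).ne_zero).mpr (prime_f₀ k)).radical

/-- `(f₁)` is a radical ideal. [folklore] -/
theorem radical_span_f₁ : (Ideal.span {f₁ k}).radical = Ideal.span {f₁ k} :=
  ((Ideal.span_singleton_prime (prime_f₁ k).ne_zero).mpr (prime_f₁ k)).radical


/-! ## The hypersurface `H = V₊(F)` is integral -/

/-- `H = V₊(F)` (reduced induced structure) is reduced. [folklore] -/
theorem isReduced_hypersurface : AlgebraicGeometry.IsReduced (hypersurface (form k)).left :=
  Literature.AlgebraicGeometry.Resolution.ComponentGluing.isReduced_subscheme_vanishingIdeal (zeroLocusClosed (form k))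

/-- **`H = V₊(F)` is an integral scheme** (`F` prime ⇒ `V₊(F)` irreducible, Hartshorne II Ex. 2.9; reduced by construction).
[folklore] -/
theorem isIntegral_hypersurface : AlgebraicGeometry.IsIntegral (hypersurface (form k)).left := by
  haveI := isReduced_hypersurface k
  have hirr : IsIrreducible (Set.range (hypersurfaceι (form k)).left) := by
    rw [range_hypersurfaceι]
    exact isIrreducible_zeroLocus_of_prime _ (isHomogeneous_form k) (prime_form k)
  haveI : IrreducibleSpace (Set.range (hypersurfaceι (form k)).left) := Subtype.irreducibleSpace hirr
  haveI : IrreducibleSpace (hypersurface (form k)).left :=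
    (hypersurfaceι (form k)).left.isClosedEmbedding.isEmbedding.toHomeomorph.irreducibleSpace_iff.mpr this
  exact AlgebraicGeometry.isIntegral_of_irreducibleSpace_of_isReduced _

/-! ## The chart rings `ChartRing F c ≅ k[y]/(f_c)` -/

section Charts

variable (c : Fin 4) (f : MvPolynomial (Fin 3) k) (hf : dehomogenize k c (form k) = f)
  (hrad : (Ideal.span {f}).radical = Ideal.span {f})

/-- Dehomogenization takes the chart equation `F/x_c³` to `F(x_c := 1)`. [folklore] -/
theorem chartAlgEquiv_chartEqn :
    chartAlgEquiv k c (chartEqn (form k) c (isHomogeneous_form k)) = dehomogenize k c (form k) := by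
  rw [chartEqn, isLocalizationElem_X]
  exact (chartAlgEquiv k c).apply_symm_apply _

include hf in
/-- Under the chart isomorphism `(k[x]_{(x_c)})₀ ≅ k[y]`, `(F/x_c³)` goes to `(f)`. [folklore] -/
theorem map_span_chartEqn :
    (Ideal.span {chartEqn (form k) c (isHomogeneous_form k)}).map (chartAlgEquiv k c).toRingEquiv.toRingHom =
      Ideal.span {f} := by
  rw [Ideal.map_span, Set.image_singleton]
  exact congrArg (fun q => Ideal.span {q}) ((chartAlgEquiv_chartEqn k c).trans hf)

include hf hrad in
/-- **The chart ideal is `(F/x_c³)` itself** (no radical needed: `(f)` is radical). [folklore] -/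
theorem chartIdeal_eq_span :
    chartIdeal (form k) c (isHomogeneous_form k) = Ideal.span {chartEqn (form k) c (isHomogeneous_form k)} := by
  have hspan : Ideal.span {chartEqn (form k) c (isHomogeneous_form k)} =
      (Ideal.span {f}).comap (chartAlgEquiv k c).toRingEquiv.toRingHom := by
    rw [← map_span_chartEqn k c f hf]
    exact (Ideal.comap_map_of_bijective (chartAlgEquiv k c).toRingEquiv.toRingHom
      (chartAlgEquiv k c).toRingEquiv.bijective).symm
  rw [chartIdeal, hspan, ← Ideal.comap_radical, hrad]

include hf hrad in
/-- Under the chart isomorphism, the chart ideal goes to `(f)`. [folklore] -/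
theorem map_chartIdeal :
    Ideal.span {f} = (chartIdeal (form k) c (isHomogeneous_form k)).map (chartAlgEquiv k c).toRingEquiv.toRingHom := by
  rw [chartIdeal_eq_span k c f hf hrad, map_span_chartEqn k c f hf]

/-- **`ChartRing F c ≅ k[y₀, y₁, y₂]/(f)`** for `f = F(x_c := 1)` with `(f)` radical (dehomogenization, Hartshorne I Thm 3.4,
on the reduced induced structure II Example 3.2.6). [folklore] -/
def chartQuotEquiv : ChartRing (form k) c (isHomogeneous_form k) ≃+* (MvPolynomial (Fin 3) k ⧸ Ideal.span {f}) :=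
  Ideal.quotientEquiv _ _ (chartAlgEquiv k c).toRingEquiv (map_chartIdeal k c f hf hrad)

/-- The chart isomorphism on classes: `[q] ↦ [q(x_c := 1)]`. [folklore] -/
theorem chartQuotEquiv_toChartRing (q : Away (MvPolynomial.homogeneousSubmodule (Fin 4) k) (X c)) :
    chartQuotEquiv k c f hf hrad (toChartRing (form k) c (isHomogeneous_form k) q) =
      Ideal.Quotient.mk _ (chartAlgEquiv k c q) :=
  Ideal.quotientEquiv_mk _ _ _ _ q

/-- **The tautological coordinate `x_{c.succAbove j}/x_c` goes to `ȳ_j`.** [folklore] -/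
theorem chartQuotEquiv_tautVec (j : Fin 3) :
    chartQuotEquiv k c f hf hrad (tautVec (form k) c (isHomogeneous_form k) (c.succAbove j)) =
      Ideal.Quotient.mk _ (X j) := by
  rw [tautVec_apply, chartQuotEquiv_toChartRing, coord_succAbove, ← chartAlgEquiv_symm_X k c j,
    AlgEquiv.apply_symm_apply]

end Charts

/-- **Every chart ideal of `H` is principal**: `(F/x_c³)` on `D₊(x_c)` (the «locally principal» binder of the item).
[folklore] -/
theorem chartIdeal_eq_span_all (c : Fin 4) :
    chartIdeal (form k) c (isHomogeneous_form k) = Ideal.span {chartEqn (form k) c (isHomogeneous_form k)} := by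
  fin_cases c
  · exact chartIdeal_eq_span k 0 (f₀ k) (dehomogenize_form_zero k) (radical_span_f₀ k)
  · exact chartIdeal_eq_span k 1 (f₁ k) (dehomogenize_form_one k) (radical_span_f₁ k)
  · exact chartIdeal_eq_span k 2 (f₂ k) (dehomogenize_form_two k) (radical_span_f₂ k)
  · exact chartIdeal_eq_span k 3 (f₃ k) (dehomogenize_form_three k) (radical_span_f₃ k)

/-! ## Transport of regularity along the chart isomorphisms -/

/-- Regularity of affine blow-up algebras transports along a ring isomorphism of the base. [folklore] -/
theorem isRegularRing_blowupAlgebra_of_ringEquiv {R S : Type} [CommRing R] [CommRing S] (e : R ≃+* S) (I : Ideal R)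
    (b : R) (h : IsRegularRing (Literature.AlgebraicGeometry.Resolution.blowupAlgebra (I.map e.toRingHom) (e b))) :
    IsRegularRing (Literature.AlgebraicGeometry.Resolution.blowupAlgebra I b) :=
  haveI := h
  IsRegularRing.of_ringEquiv (Literature.AlgebraicGeometry.Resolution.blowupAlgebra.congrEquiv e I b).symm

/-- **The chart rings off the double line are regular**: `ChartRing F 2 ≅ k[y]/(f₂)` and `ChartRing F 3 ≅ k[y]/(f₃)`.
[folklore] -/
theorem isRegularRing_chartRing_of_two_le (c : Fin 4) (hc : 2 ≤ (c : ℕ)) :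
    IsRegularRing (ChartRing (form k) c (isHomogeneous_form k)) := by
  have hc' : c = 2 ∨ c = 3 := by
    fin_cases c <;> simp at hc ⊢
  rcases hc' with rfl | rfl
  · haveI := isRegularRing_quotient_f₂ k
    exact IsRegularRing.of_ringEquiv (chartQuotEquiv k 2 (f₂ k) (dehomogenize_form_two k) (radical_span_f₂ k)).symm
  · haveI := isRegularRing_quotient_f₃ k
    exact IsRegularRing.of_ringEquiv (chartQuotEquiv k 3 (f₃ k) (dehomogenize_form_three k) (radical_span_f₃ k)).symm


/-- `cen j = y_{j+1}`. [folklore] -/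
theorem cen_eq_X_succ (j : Fin 2) : cen k j = X j.succ := by
  fin_cases j <;> rfl

/-- **The blow-up chart rings over `ChartRing F c` (`c = 0, 1`) are regular**, transported from `…WhitneyCubicAlgebra` along
`ChartRing F c ≅ k[y]/(f_c)`: for the centre `I = (x₂/x_c, x₃/x_c)` of the double line and `b = x_a/x_c`, `a = 2, 3`, the
affine blowup algebra `(ChartRing F c)[I/b]` is a regular ring whenever `(k[y]/(f_c))[(ȳ₁, ȳ₂)/ȳ_{j+1}]` is. [folklore] -/
theorem isRegularRing_blowupAlgebra_tautVec (c : Fin 4) (f : MvPolynomial (Fin 3) k) (hf : dehomogenize k c (form k) = f)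
    (hrad : (Ideal.span {f}).radical = Ideal.span {f}) (hc2 : (2 : Fin 4) = c.succAbove 1) (hc3 : (3 : Fin 4) = c.succAbove 2)
    (j : Fin 2) (a : Fin 4) (ha : a = c.succAbove j.succ)
    (hreg : IsRegularRing (Literature.AlgebraicGeometry.Resolution.blowupAlgebra
      ((Ideal.span (Set.range (cen k))).map (Ideal.Quotient.mk (Ideal.span {f}))) (Ideal.Quotient.mk (Ideal.span {f}) (cen k j)))) :
    IsRegularRing (Literature.AlgebraicGeometry.Resolution.blowupAlgebra
      (Ideal.span {tautVec (form k) c (isHomogeneous_form k) 2, tautVec (form k) c (isHomogeneous_form k) 3})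
      (tautVec (form k) c (isHomogeneous_form k) a)) := by
  have h2 : chartQuotEquiv k c f hf hrad (tautVec (form k) c (isHomogeneous_form k) 2) = Ideal.Quotient.mk _ (X 1) := by
    rw [hc2]; exact chartQuotEquiv_tautVec k c f hf hrad 1
  have h3 : chartQuotEquiv k c f hf hrad (tautVec (form k) c (isHomogeneous_form k) 3) = Ideal.Quotient.mk _ (X 2) := by
    rw [hc3]; exact chartQuotEquiv_tautVec k c f hf hrad 2
  have hb : chartQuotEquiv k c f hf hrad (tautVec (form k) c (isHomogeneous_form k) a) =
      Ideal.Quotient.mk (Ideal.span {f}) (cen k j) := by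
    rw [ha, chartQuotEquiv_tautVec, cen_eq_X_succ]
  have hI : (Ideal.span {tautVec (form k) c (isHomogeneous_form k) 2, tautVec (form k) c (isHomogeneous_form k) 3}).map
      (chartQuotEquiv k c f hf hrad).toRingHom =
        (Ideal.span (Set.range (cen k))).map (Ideal.Quotient.mk (Ideal.span {f})) := by
    rw [Ideal.map_span, Set.image_pair, Ideal.map_span, range_cen, Set.image_image, Set.image_pair]
    exact congrArg₂ (fun u v => Ideal.span {u, v}) h2 h3
  refine isRegularRing_blowupAlgebra_of_ringEquiv (chartQuotEquiv k c f hf hrad)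
    (Ideal.span {tautVec (form k) c (isHomogeneous_form k) 2, tautVec (form k) c (isHomogeneous_form k) 3})
    (tautVec (form k) c (isHomogeneous_form k) a) ?_
  rw [hI, hb]
  exact hreg

end WhitneyCubic

end Summit.ResolutionOfSingularities.ResolutionOfSingularities.Cruxes.EquisingularLiftNat.Sections

end
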